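import Literature.NumberTheory.EllipticCurves.FormalGroupChart
import Literature.NumberTheory.EllipticCurves.GoodModelInertiaCriterionProofs
import Literature.NumberTheory.EllipticCurves.SerreOpenImageTameKummerProofs
import Literature.NumberTheory.EllipticCurves.OrdinaryReductionKernelTorsionProofs
import Literature.NumberTheory.EllipticCurves.KernelReductionInertiaProofs
import Literature.NumberTheory.EllipticCurves.OpenImageMazurInputs
import Literature.NumberTheory.EllipticCurves.VariableChangePointsMap
import Mathlib.AlgebraicGeometry.EllipticCurve.NormalForms
import HarnessLib

/-!
# Route `IsogenyGlueCongruence`, crux `MazurKenkuBound` (stmt-ABC-15125) — line `Sketch`, stub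
# `stub_range_of` (Mazur 1978 Prop. 5.1 by tame characters), part 2: the twisted good model

Helpers (`--supports stmt-ABC-15125`) for the registered stub `stub_range_of` (theorem in
`IsogenyGlueCongruenceMazurKenkuBoundStubRangeOf`). This file: values of rationals as powers of `|N|`,
the twisting exponent `12 n' = e n`; for a short Weierstrass equation over `ℚ` with `j` integral at
`N ≥ 5`, the exponents `e ∈ {1,2,3,4,6}`, `n'` and the root `ρ'` (`ρ'^{e(N-1)} = N`) with
`|a₄| ≤ |u|⁴`, `|a₆| ≤ |u|⁶`, `|Δ| = |u|¹²` for `u = (ρ'^{N-1})^{n'}` (`exists_goodTwist`: `ord j ≥ 0`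
forces `3 ord c₄ ≥ ord Δ`, `2 ord c₆ ≥ ord Δ`, and `ord Δ` even unless `3 ∣ ord Δ`), and the
resulting integral model with unit discriminant over the valuation ring (`exists_integralTwistModel`).

References: [Mazur1978] B. Mazur, Invent. Math. 44 (1978), §5, proof of Prop. 5.1 (p. 150);
[SilvermanAEC2009] J. H. Silverman, *The Arithmetic of Elliptic Curves*, 2nd ed., III.1 Table 3.1,
VII.1, VII.5 Prop. 5.5 (potentially good reduction over an extension of ramification `e ∣ 12`).
-/

-- `Summit.<Summit>.<Problem>` is the mandated summit-side namespace (CONVENTIONS §2); for the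
-- single-conjunct summit `ABC` the two coincide, so the duplicate `ABC.ABC` is deliberate.
set_option linter.dupNamespace false

noncomputable section

open scoped NNReal NumberField Classical

open WeierstrassCurve IsDedekindDomain Field NumberField
open Literature.NumberTheory.EllipticCurves
open Literature.NumberTheory.GaloisRepresentations

-- The `ℚ`-algebra diamond on `AlgebraicClosure ℚ` (`DivisionRing.toRatAlgebra` vs
-- `AlgebraicClosure.instAlgebra`, defeq but not at instance transparency): the Galois-module
-- structures of the tree are keyed on the latter (same device as `GeomPointReduction`).
attribute [-instance] DivisionRing.toRatAlgebra

namespace Summit.ABC.ABC.Theorems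

/-! ### Exponents and values of rationals -/

/-- The twisting exponent: for an integer `n` which is even whenever it is prime to `3`, there are
`e ∈ {1, 2, 3, 4, 6}` and `n'` with `12 n' = e n` (`e = 12 / gcd(12, n)` up to the harmless
freedom of the choice). [folklore] -/
theorem exists_twelve_mul_eq (n : ℤ) (h : ¬ (3 : ℤ) ∣ n → (2 : ℤ) ∣ n) :
    ∃ e ∈ ({1, 2, 3, 4, 6} : Finset ℕ), ∃ n' : ℤ, 12 * n' = e * n := by
  by_cases h3 : (3 : ℤ) ∣ n
  · obtain ⟨k, rfl⟩ := h3
    by_cases h2 : (2 : ℤ) ∣ k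
    · obtain ⟨l, rfl⟩ := h2
      exact ⟨2, by simp, l, by ring⟩
    · exact ⟨4, by simp, k, by ring⟩
  · obtain ⟨k, rfl⟩ := h h3
    by_cases h2 : (2 : ℤ) ∣ k
    · obtain ⟨l, rfl⟩ := h2
      exact ⟨3, by simp, l, by ring⟩
    · exact ⟨6, by simp, k, by ring⟩

/-- **Values of rationals**: if a valuation `w` of a field of characteristic `0` takes the value
`1` on the integers prime to the prime `N`, then every nonzero rational has value an integral
power of `|N|` (factor numerator and denominator as `N^a · m`, `N ∤ m`). [folklore] -/
theorem exists_val_ratCast_eq_zpow {L : Type*} [Field L] [CharZero L] (w : Valuation L ℝ≥0)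
    {N : ℕ} (hN : N.Prime) (hint : ∀ n : ℤ, ¬ (N : ℤ) ∣ n → w (n : L) = 1) {q : ℚ} (hq : q ≠ 0) :
    ∃ m : ℤ, w (q : L) = w (N : L) ^ m := by
  have hN0 : w (N : L) ≠ 0 := by
    rw [Valuation.ne_zero_iff]; exact_mod_cast hN.ne_zero
  -- numerator and denominator
  have hnum0 : q.num.natAbs ≠ 0 := Int.natAbs_ne_zero.mpr (Rat.num_ne_zero.mpr hq)
  obtain ⟨a, m₁, hm₁, ha⟩ := Nat.exists_eq_pow_mul_and_not_dvd hnum0 N hN.one_lt.ne'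
  obtain ⟨b, m₂, hm₂, hb⟩ := Nat.exists_eq_pow_mul_and_not_dvd q.den_nz N hN.one_lt.ne'
  have hwm₁ : w (m₁ : L) = 1 := by
    have := hint m₁ (by exact_mod_cast hm₁)
    simpa using this
  have hwm₂ : w (m₂ : L) = 1 := by
    have := hint m₂ (by exact_mod_cast hm₂)
    simpa using this
  -- `|num| = |N|^a`, `|den| = |N|^b`
  have hwnum : w (q.num : L) = w (N : L) ^ a := by
    have e1 : w (q.num : L) = w ((q.num.natAbs : ℕ) : L) := by
      rcases Int.natAbs_eq q.num with h1 | h1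
      · conv_lhs => rw [h1, Int.cast_natCast]
      · conv_lhs => rw [h1, Int.cast_neg, Int.cast_natCast, Valuation.map_neg]
    rw [e1, ha]
    push_cast
    rw [map_mul, map_pow, hwm₁, mul_one]
  have hwden : w (q.den : L) = w (N : L) ^ b := by
    rw [hb]
    push_cast
    rw [map_mul, map_pow, hwm₂, mul_one]
  refine ⟨(a : ℤ) - b, ?_⟩
  have hq' : (q : L) = (q.num : L) / (q.den : L) := by
    rw [← Rat.cast_intCast, ← Rat.cast_natCast, ← Rat.cast_div, Rat.num_div_den]
  rw [hq', map_div₀, hwnum, hwden, zpow_sub₀ hN0, zpow_natCast, zpow_natCast]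

/-- A prime `N ≥ 5` divides no number of the form `2ᵃ3ᵇ`. [folklore] -/
theorem not_dvd_two_pow_mul_three_pow {N : ℕ} (hN : N.Prime) (h5 : 5 ≤ N) (a b : ℕ) :
    ¬ (N : ℤ) ∣ ((2 ^ a * 3 ^ b : ℕ) : ℤ) := by
  intro h
  have h' : N ∣ 2 ^ a * 3 ^ b := Int.natCast_dvd_natCast.mp h
  rcases (Nat.Prime.dvd_mul hN).mp h' with h2 | h3
  · have := Nat.le_of_dvd two_pos (hN.dvd_of_dvd_pow h2); omega
  · have := Nat.le_of_dvd (by norm_num) (hN.dvd_of_dvd_pow h3); omega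

/-! ### The twisted good model: exponents and integrality -/

/-- **The twist.** For a short Weierstrass equation `y² = x³ + a₄x + a₆` over `ℚ` with `j`
integral at `N` (`|j| ≤ 1` for a valuation `w` above `N ≥ 5`), there are `e ∈ {1,2,3,4,6}`,
`n' ∈ ℤ` and `ρ' ∈ ℚ̄` with `ρ'^{e(N-1)} = N` such that `u = (ρ'^{N-1})^{n'}` (`= ρ^{n'}`,
`ρ = N^{1/e}`) satisfies `|a₄| ≤ |u|⁴`, `|a₆| ≤ |u|⁶`, `|Δ| = |u|¹²`: the diagonal change of
variables `(u; 0, 0, 0)` gives an integral model with unit discriminant over the valuation ring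
(Silverman AEC VII.5.5: potentially good reduction is acquired over an extension of ramification
`e = 12/gcd(12, ord Δ)`; `ord j ≥ 0` forces `3 ord c₄ ≥ ord Δ`, `2 ord c₆ ≥ ord Δ`, and
`ord Δ` even unless `3 ∣ ord Δ`). [cite: SilvermanAEC2009, VII.5 Prop. 5.5 and III.1] -/
theorem exists_goodTwist (w : Valuation (AlgebraicClosure ℚ) ℝ≥0) {N : ℕ} (hN : N.Prime)
    (h5 : 5 ≤ N) (hNlt : w (N : AlgebraicClosure ℚ) < 1)
    (hint : ∀ n : ℤ, ¬ (N : ℤ) ∣ n → w (n : AlgebraicClosure ℚ) = 1)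
    (X : WeierstrassCurve ℚ) [X.IsElliptic] [X.IsShortNF]
    (hj : w (X.j : AlgebraicClosure ℚ) ≤ 1) :
    ∃ e ∈ ({1, 2, 3, 4, 6} : Finset ℕ), ∃ (n' : ℤ) (ρ' : AlgebraicClosure ℚ), ρ' ≠ 0 ∧
      ρ' ^ (e * (N - 1)) = N ∧
      w (X.a₄ : AlgebraicClosure ℚ) ≤ w ((ρ' ^ (N - 1)) ^ n') ^ 4 ∧
      w (X.a₆ : AlgebraicClosure ℚ) ≤ w ((ρ' ^ (N - 1)) ^ n') ^ 6 ∧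
      w (X.Δ : AlgebraicClosure ℚ) = w ((ρ' ^ (N - 1)) ^ n') ^ 12 := by
  set L := AlgebraicClosure ℚ
  set t : ℝ≥0 := w (N : L) with htdef
  have ht0 : 0 < t := zero_lt_iff.mpr (by
    rw [htdef, Valuation.ne_zero_iff]; exact_mod_cast hN.ne_zero)
  have hanti := zpow_right_strictAnti₀ ht0 hNlt
  have hinj := zpow_right_injective₀ ht0 hNlt.ne
  -- values of the constants `1728 = 2⁶3³`, `48 = 2⁴3`, `864 = 2⁵3³`
  have hw_nat : ∀ a b : ℕ, w ((2 ^ a * 3 ^ b : ℕ) : L) = 1 := fun a b ↦ by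
    have h := hint _ (not_dvd_two_pow_mul_three_pow hN h5 a b)
    rwa [Int.cast_natCast] at h
  have h1728 : w (1728 : L) = 1 := by have h := hw_nat 6 3; norm_num at h; exact h
  have h48 : w (48 : L) = 1 := by have h := hw_nat 4 1; norm_num at h; exact h
  have h864 : w (864 : L) = 1 := by have h := hw_nat 5 3; norm_num at h; exact h
  -- `|Δ| = tⁿ`
  have hΔ0 : X.Δ ≠ 0 := by rw [← coe_Δ']; exact X.Δ'.ne_zero
  obtain ⟨n, hn⟩ := exists_val_ratCast_eq_zpow w hN hint hΔ0
  -- `c₄³ = Δ j`, `c₆² = c₄³ - 1728 Δ` (cast to `L`)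
  have hc4 : ((X.c₄ : ℚ) : L) ^ 3 = (X.Δ : L) * (X.j : L) := by
    have h : X.c₄ ^ 3 = X.Δ * X.j := by
      rw [WeierstrassCurve.j, ← mul_assoc, ← coe_Δ', Units.mul_inv, one_mul]
    exact_mod_cast congrArg (fun q : ℚ ↦ (q : L)) h
  have hc6 : ((X.c₆ : ℚ) : L) ^ 2 = -(1728 * (X.Δ : L)) + (X.c₄ : L) ^ 3 := by
    have h : X.c₆ ^ 2 = -(1728 * X.Δ) + X.c₄ ^ 3 := by
      linear_combination X.c_relation
    exact_mod_cast congrArg (fun q : ℚ ↦ (q : L)) h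
  have hw1728Δ : w (-(1728 * (X.Δ : L))) = t ^ n := by
    rw [Valuation.map_neg, map_mul, h1728, one_mul, hn]
  have hc4le : w ((X.c₄ : ℚ) : L) ^ 3 ≤ t ^ n := by
    rw [← map_pow, hc4, map_mul, hn]
    calc t ^ n * w ((X.j : ℚ) : L) ≤ t ^ n * 1 := by gcongr
      _ = t ^ n := mul_one _
  have hc4le' : w (((X.c₄ : ℚ) : L) ^ 3) ≤ t ^ n := by rw [map_pow]; exact hc4le
  have hc6le : w ((X.c₆ : ℚ) : L) ^ 2 ≤ t ^ n := by
    rw [← map_pow, hc6]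
    exact (w.map_add _ _).trans (max_le hw1728Δ.le hc4le')
  -- parity of `n`
  have hpar : ¬ (3 : ℤ) ∣ n → (2 : ℤ) ∣ n := by
    intro h3
    -- `|c₄³| < |1728 Δ|`
    have hlt : w (((X.c₄ : ℚ) : L) ^ 3) < w (-(1728 * (X.Δ : L))) := by
      rw [hw1728Δ, map_pow]
      by_cases hc40 : X.c₄ = 0
      · rw [hc40, Rat.cast_zero, map_zero, zero_pow three_ne_zero]
        exact zpow_pos ht0 n
      · obtain ⟨k, hk⟩ := exists_val_ratCast_eq_zpow w hN hint hc40
        rw [hk, ← zpow_natCast, ← zpow_mul]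
        have hle : t ^ (k * ((3 : ℕ) : ℤ)) ≤ t ^ n := by
          rw [zpow_mul, zpow_natCast, ← hk]; exact hc4le
        have hne : k * ((3 : ℕ) : ℤ) ≠ n := fun h ↦ h3 ⟨k, by rw [← h]; push_cast; ring⟩
        rcases lt_or_gt_of_ne hne with hlt' | hgt'
        · exact absurd hle (not_le.mpr (hanti hlt'))
        · exact hanti hgt'
    have hc6eq : w ((X.c₆ : ℚ) : L) ^ 2 = t ^ n := by
      rw [← map_pow, hc6, w.map_add_eq_of_lt_left hlt, hw1728Δ]
    have hc60 : X.c₆ ≠ 0 := by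
      intro h0
      rw [h0, Rat.cast_zero, map_zero, zero_pow two_ne_zero] at hc6eq
      exact (zpow_pos ht0 n).ne' hc6eq.symm
    obtain ⟨l, hl⟩ := exists_val_ratCast_eq_zpow w hN hint hc60
    rw [hl, ← zpow_natCast, ← zpow_mul] at hc6eq
    exact ⟨l, by have := hinj hc6eq; push_cast at this; linarith⟩
  obtain ⟨e, he, n', hn'⟩ := exists_twelve_mul_eq n hpar
  -- `ρ'` with `ρ'^{e(N-1)} = N`
  have he0 : 0 < e := by
    simp only [Finset.mem_insert, Finset.mem_singleton] at he
    rcases he with rfl | rfl | rfl | rfl | rfl <;> norm_num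
  have hN1 : 0 < N - 1 := by have := hN.two_le; omega
  obtain ⟨ρ', hρ'⟩ := IsAlgClosed.exists_pow_nat_eq (N : L) (Nat.mul_pos he0 hN1)
  have hρ'0 : ρ' ≠ 0 := by
    intro h0
    rw [h0, zero_pow (Nat.mul_pos he0 hN1).ne'] at hρ'
    exact (Nat.cast_ne_zero.mpr hN.ne_zero) hρ'.symm
  set g : ℝ≥0 := w ρ' with hgdef
  set G : ℝ≥0 := g ^ (N - 1) with hGdef
  have hG0 : G ≠ 0 := pow_ne_zero _ ((Valuation.ne_zero_iff w).mpr hρ'0)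
  have hGe : G ^ e = t := by
    rw [hGdef, ← pow_mul, mul_comm, hgdef, ← map_pow, hρ']
  have hwu : w ((ρ' ^ (N - 1)) ^ n') = G ^ n' := by
    rw [map_zpow₀, map_pow]
  have hwu12 : w ((ρ' ^ (N - 1)) ^ n') ^ 12 = t ^ n := by
    rw [hwu, ← zpow_natCast, ← zpow_mul, show n' * ((12 : ℕ) : ℤ) = (e : ℤ) * n by
      push_cast; linarith, zpow_mul, zpow_natCast, hGe]
  refine ⟨e, he, n', ρ', hρ'0, hρ', ?_, ?_, ?_⟩
  · -- `|a₄|³ = |c₄|³ ≤ |Δ| = (|u|⁴)³`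
    have ha4 : w ((X.a₄ : ℚ) : L) = w ((X.c₄ : ℚ) : L) := by
      rw [X.c₄_of_isShortNF]; push_cast
      rw [map_mul, Valuation.map_neg, h48, one_mul]
    refine le_of_pow_le_pow_left₀ three_ne_zero zero_le ?_
    rw [ha4, ← pow_mul, show 4 * 3 = 12 by norm_num, hwu12]
    exact hc4le
  · have ha6 : w ((X.a₆ : ℚ) : L) = w ((X.c₆ : ℚ) : L) := by
      rw [X.c₆_of_isShortNF]; push_cast
      rw [map_mul, Valuation.map_neg, h864, one_mul]
    refine le_of_pow_le_pow_left₀ two_ne_zero zero_le ?_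
    rw [ha6, ← pow_mul, show 6 * 2 = 12 by norm_num, hwu12]
    exact hc6le
  · rw [hwu12]; exact hn

/-! ### The integral twisted model -/

/-- **The twisted model is integral with unit discriminant**: for a short Weierstrass equation
`X/ℚ` and `u ∈ ℚ̄ˣ` with `|a₄| ≤ |u|⁴`, `|a₆| ≤ |u|⁶`, `|Δ| = |u|¹²`, the equation
`(u; 0, 0, 0) • X_{ℚ̄}` (`a₄' = u⁻⁴a₄`, `a₆' = u⁻⁶a₆`) has coefficients in the valuation ring of
`w` and unit discriminant there. [cite: SilvermanAEC2009, III.1 Table 3.1 and VII.1] -/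
theorem exists_integralTwistModel (w : Valuation (AlgebraicClosure ℚ) ℝ≥0) (X : WeierstrassCurve ℚ)
    [X.IsShortNF] {u : AlgebraicClosure ℚ} (hu0 : u ≠ 0)
    (ha4 : w (X.a₄ : AlgebraicClosure ℚ) ≤ w u ^ 4) (ha6 : w (X.a₆ : AlgebraicClosure ℚ) ≤ w u ^ 6)
    (hΔ : w (X.Δ : AlgebraicClosure ℚ) = w u ^ 12) :
    ∃ W₀ : WeierstrassCurve w.integer,
      (⟨Units.mk0 u hu0, 0, 0, 0⟩ : VariableChange (AlgebraicClosure ℚ)) •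
          X.baseChange (AlgebraicClosure ℚ) = W₀.baseChange (AlgebraicClosure ℚ) ∧ IsUnit W₀.Δ := by
  let L := AlgebraicClosure ℚ
  have hv0 : w.Integers w.integer := Valuation.integer.integers w
  have hwu0 : w u ≠ 0 := (Valuation.ne_zero_iff w).mpr hu0
  set uU : Lˣ := Units.mk0 u hu0 with huU
  set CL : VariableChange L := ⟨uU, 0, 0, 0⟩ with hCL
  have hmem4 : ((uU⁻¹ : Lˣ) : L) ^ 4 * (X.a₄ : L) ∈ w.integer := by
    rw [Valuation.mem_integer_iff, map_mul, map_pow, Units.val_inv_eq_inv_val, map_inv₀, huU,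
      Units.val_mk0]
    calc (w u)⁻¹ ^ 4 * w (X.a₄ : L) ≤ (w u)⁻¹ ^ 4 * w u ^ 4 := by gcongr
      _ = 1 := by rw [← mul_pow, inv_mul_cancel₀ hwu0, one_pow]
  have hmem6 : ((uU⁻¹ : Lˣ) : L) ^ 6 * (X.a₆ : L) ∈ w.integer := by
    rw [Valuation.mem_integer_iff, map_mul, map_pow, Units.val_inv_eq_inv_val, map_inv₀, huU,
      Units.val_mk0]
    calc (w u)⁻¹ ^ 6 * w (X.a₆ : L) ≤ (w u)⁻¹ ^ 6 * w u ^ 6 := by gcongr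
      _ = 1 := by rw [← mul_pow, inv_mul_cancel₀ hwu0, one_pow]
  set W₀ : WeierstrassCurve w.integer := ⟨0, 0, 0, ⟨_, hmem4⟩, ⟨_, hmem6⟩⟩ with hW₀def
  have hbc : ∀ q : ℚ, algebraMap ℚ L q = (q : L) := fun q ↦ by rw [eq_ratCast]
  have hW₀ : CL • X.baseChange L = W₀.baseChange L := by
    rw [hW₀def]
    ext
    · simp [hCL, WeierstrassCurve.baseChange, variableChange_a₁]
    · simp [hCL, WeierstrassCurve.baseChange, variableChange_a₂]
    · simp [hCL, WeierstrassCurve.baseChange, variableChange_a₃]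
    · change (CL • X.baseChange L).a₄ = ((uU⁻¹ : Lˣ) : L) ^ 4 * (X.a₄ : L)
      rw [variableChange_a₄]
      simp [hCL, WeierstrassCurve.baseChange, hbc]
    · change (CL • X.baseChange L).a₆ = ((uU⁻¹ : Lˣ) : L) ^ 6 * (X.a₆ : L)
      rw [variableChange_a₆]
      simp [hCL, WeierstrassCurve.baseChange, hbc]
  refine ⟨W₀, hW₀, ?_⟩
  apply (hv0.isUnit_iff_valuation_eq_one).mpr
  change w ((algebraMap w.integer L) W₀.Δ) = 1
  rw [← map_Δ]
  change w (W₀.baseChange L).Δ = 1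
  rw [← hW₀, variableChange_Δ, map_mul, map_pow, hCL, Units.val_inv_eq_inv_val, map_inv₀, huU,
    Units.val_mk0, show (X.baseChange L).Δ = (X.Δ : L) by
      rw [WeierstrassCurve.baseChange, map_Δ, eq_ratCast], hΔ, ← mul_pow, inv_mul_cancel₀ hwu0,
    one_pow]

end Summit.ABC.ABC.Theorems

end
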